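import Summits.BirchSwinnertonDyer.BirchSwinnertonDyer.Theorems.ErratumRoadFiveNonSurjCornerKolyJMaxOfPerLevel
import HarnessLib

/-!
# Route `ErratumRoadFive` (rung K2), crux child `NonSurjCornerKolyJ` (item stmt-BirchSwinnertonDyer-19947), registered stub
# `stub_kolyJ_max` — and the 19111 kit's `stub_upper3_jetchevMax`, and 19109's `stub_jetchevMaxHLAtThree` —: the hK
# input «KOLYVAGIN'S REDEFINITION of `m_∞`» in the TREE's currency FROM THE PRIME SWAP, and the displays re-keyed
# «stub ⟸ {hfin, hswap, hlev}» (cell `bsd-stepL`, seat `bsd-stepL-corner-p1` g8; `--supports stmt-BirchSwinnertonDyer-19947`)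

WHAT. The reading-grade displays `Koly.nonSurjCornerKolyJ_max_of_perLevel` ∕ `Koly.cornerUpper3_jetchevMax_of_perLevel`
(p502196) and tam3-p1's `Koly.jetchevMaxHLAtThree_of_perLevel` take `hK` = «there is `m_∞ : ℕ` with `m_∞ ≤ m(n)` for
every admissible `(n, d)` of the frame, attained at admissible conductors of arbitrarily large index `M(n)`» (McCallum 1991
Lemma 5.1 + Prop. 5.2 with `C = {0}`; at `p = 3` under `ρ̄` onto the typed fact `McCallum1991.prop52_…`, VOID on the
(T4′)∕(T4″) corners whose image is not onto). Here `hK` becomes a THEOREM of two per-frame inputs: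
* `hfin` — some admissible `(n, d)` has `ord_p(P_n) < M(n)` (on every frame of the three stubs: `n = 1`, `M(1) = ∞`,
  `ord_p(y_K) < ∞` because `y_K` has infinite order — Gross–Zagier at analytic rank 1; McCallum Lemma 5.1
  «`M₀ = ord_p[E(K) : ℤy_K]` … In particular, `M₀` is finite»; the reduction to `n = 1` is `exists_finite_of_not_pDiv`);
* `hswap` — the PRIME SWAP at the frame: for every `M, e`, an admissible `(n, d)` over Kolyvagin primes of index
  `≥ M + 1` with `P_n ∉ p^{M+1} E(K[n])`, such that EVERY admissible `(n', d')` over index `≥ M + 1` has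
  `P_{n'} ∈ p^M E(K[n'])`, yields an admissible `(n', d')` over index `≥ e` with `P_{n'} ∉ p^{M+1} E(K[n'])` — the
  conclusion of the abstract kernel theorem `JET.Section6.exists_deep_conductor_of_swap` (`…NonSurjCornerKolyJSwap.lean`,
  this seat: McCallum Prop. 5.2 ∕ BCGS Prop. 2.2.1 over the walk's block-1 data + a level-`p` pairing package) once its
  data are instantiated at the frame at level `p` with `κ̄_n :=` the level-`p` class of `c_{M+1}(n)` — an instantiation
  layer of the same kind as (and smaller than) the walk's, NOT in the tree.
So after this file the three max-form stubs read «⟸ {hfin (GZ), hswap (swap supply), hlev (walk supply)}», with BOTH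
supplies' abstract kernels proved (`exists_deep_conductor_of_swap`, `tamagawaExponent_le_m_of_selmerFamilies`) and NO
appeal to McCallum's Prop. 5.2 as a fact — on the corner (where no printed source proves it under irreducibility) as at 3.
* §1 `natCast_le_divOrd_of_pDiv`, `exists_finite_of_not_pDiv` (bookkeeping on `Koly.divOrd`);
* §2 **`kolyvaginRedefinition_of_swap`** — frame-generic: `hfin → hswap → hK` (the hK clause VERBATIM, `p` and the level
  `N` generic); proof: `m_∞ :=` the least finite value (`Nat.sInf`), attained at some `(n₁, d₁)`, necessarily over index
  `≥ m_∞ + 1`; minimality gives the «every conductor over index `≥ m_∞ + 1` is `p^{m_∞}`-divisible» clause; the swap at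
  depth `max m' (m_∞ + 2)` returns a deep conductor with `ord_p = m_∞ < M`.
* §3 displays: **`nonSurjCornerKolyJ_max_of_swap_of_perLevel`** (conclusion = `stub_kolyJ_max` VERBATIM),
  **`cornerUpper3_jetchevMax_of_swap_of_perLevel`** (= `stub_upper3_jetchevMax` of the 19111 Upper kit VERBATIM),
  and — in the sibling `…EulerHalvesAtThreeJetchevMaxOfSwap.lean` — `jetchevMaxHLAtThree_of_swap_of_perLevel`
  (= 19109's `stub_jetchevMaxHLAtThree` VERBATIM; courtesy for tam3-p1).
HONEST FRAMING: theorems only (no definition, no named fact, no `sorry`); hfin ∕ hswap ∕ hlev are HYPOTHESES; no stub is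
discharged; nothing asserted about any curve; no item closes; BSD not advanced (T7).

References: [McCallumLMS1991] §5 Lemma 5.1, Prop. 5.2 (pp. 303–306); [BurungaleEtAl2026] Prop. 2.2.1; [Jetchev2008] Proof of
Thm. 1.1 (p. 824); [WZhang2014] Notations (xii); tree: p502196, tam3 p486881 ∕ p486458, this seat's `…KolyJSwap`.
-/

set_option autoImplicit false

noncomputable section

open scoped Classical NumberField

namespace Summit.BirchSwinnertonDyer.Rank1Residual.X11b.Three.Koly

open WeierstrassCurve Literature.NumberTheory.EllipticCurves
  Literature.NumberTheory.EllipticCurves.ModularForms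
  Literature.NumberTheory.EllipticCurves.Rank1Residual
  Summit.BirchSwinnertonDyer.Rank1Residual Summit.BirchSwinnertonDyer.Rank1Residual.X11b
  IsDedekindDomain NumberField

universe u

/-! ### §1 Bookkeeping on `ord_p(P_n)` -/

section Bookkeeping

variable {N : ℕ} [NeZero N] {W : WeierstrassCurve ℚ} {K : Type u} [Field K] [NumberField K]
  {Dt : ModularParametrizationData W N} {β : ℤ} {ι : K →+* ℂ}

/-- `p^M | P_n` gives `M ≤ ord_p(P_n)` (the supremum defining `Koly.divOrd`). [cite: McCallumLMS1991, §5 (p. 303)] -/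
theorem natCast_le_divOrd_of_pDiv {n : ℕ} (d : KolyvaginHeegnerData Dt β ι n) (p : ℕ) {M : ℕ}
    (h : PDiv d p M) : (M : ℕ∞) ≤ divOrd d p :=
  le_iSup₂_of_le (f := fun (M : ℕ) (_ : PDiv d p M) => (M : ℕ∞)) M h le_rfl

variable [W.IsGloballyMinimal]

/-- The `n = 1` instance of `hfin`: if the conductor-`1` derived point `P₁ = y_K` is not `p^{M+1}`-divisible in
`E(K[1])`, then some admissible `(n, d)` has `ord_p(P_n) < M(n)` (`M(1) = ∞`). McCallum Lemma 5.1 («`M₀` is finite»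
for `y_K` of infinite order). [cite: McCallumLMS1991, §5 Lemma 5.1 (p. 303)] [cite: WZhang2014, Notations (xii)] -/
theorem exists_finite_of_not_pDiv {p M : ℕ} (d₁ : KolyvaginHeegnerData Dt β ι 1) (h : ¬ PDiv d₁ p (M + 1)) :
    ∃ (n : ℕ) (d : KolyvaginHeegnerData Dt β ι n), Squarefree n ∧
      (∀ ℓ ∈ n.primeFactors, Zhang2014.IsKolyvaginPrime N W K p ℓ) ∧
      divOrd d p < Zhang2014.levelIndex W p n := by
  refine ⟨1, d₁, squarefree_one, by simp, ?_⟩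
  rw [Zhang2014.levelIndex_one]
  exact lt_of_le_of_lt (divOrd_le_of_not_pDiv d₁ p h) (ENat.coe_lt_top M)

end Bookkeeping

/-! ### §2 Kolyvagin's redefinition of `m_∞` from the prime swap (frame-generic) -/

section Redefinition

variable {N : ℕ} [NeZero N] {W : WeierstrassCurve ℚ} {K : Type u} [Field K] [NumberField K]
  {Dt : ModularParametrizationData W N} {β : ℤ} {ι : K →+* ℂ} [W.IsGloballyMinimal]

/-- **Kolyvagin's redefinition of `m_∞` (McCallum 1991 Lemma 5.1 + Prop. 5.2, `C = {0}`) FROM THE PRIME SWAP — the hK clause of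
the three max-form displays VERBATIM, at one frame `(Dt, β, ι)`, prime `p`.** `hfin`: some admissible `(n, d)` (square-free
`n`, all prime factors Kolyvagin primes) has `ord_p(P_n) < M(n)`. `hswap`: for all `M e : ℕ` and admissible `(n, d)` over
Kolyvagin primes of index `≥ M + 1` with `P_n ∉ p^{M+1}E(K[n])`, if every admissible `(n', d')` over index `≥ M + 1` has
`P_{n'} ∈ p^M E(K[n'])`, then some admissible `(n', d')` over index `≥ e` has `P_{n'} ∉ p^{M+1}E(K[n'])` — the instantiated
conclusion of `JET.Section6.exists_deep_conductor_of_swap`. CONCLUSION: `∃ m_∞ : ℕ`, `m_∞ ≤ m(n, d)` for every admissible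
`(n, d)` (`m := ord_p(P_n)` if `< M(n)`, else `∞`) and for every `m'` an admissible `(n, d)` with `m' ≤ M(n)` and
`m(n, d) = m_∞`. CONDITIONAL on hfin, hswap; nothing booked.
[cite: McCallumLMS1991, §5 Lemma 5.1, Prop. 5.2 (pp. 303–306)] [cite: BurungaleEtAl2026, Prop. 2.2.1 (§2.2)]
[cite: Jetchev2008, Proof of Thm. 1.1 (p. 824)] -/
theorem kolyvaginRedefinition_of_swap (p : ℕ)
    (hfin : ∃ (n : ℕ) (d : KolyvaginHeegnerData Dt β ι n), Squarefree n ∧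
      (∀ ℓ ∈ n.primeFactors, Zhang2014.IsKolyvaginPrime N W K p ℓ) ∧
      divOrd d p < Zhang2014.levelIndex W p n)
    (hswap : ∀ (M e : ℕ) (n : ℕ) (d : KolyvaginHeegnerData Dt β ι n), Squarefree n →
      (∀ ℓ ∈ n.primeFactors, Zhang2014.IsKolyvaginPrime N W K p ℓ ∧ M + 1 ≤ Zhang2014.kolyvaginIndex W p ℓ) →
      (∀ (n' : ℕ) (d' : KolyvaginHeegnerData Dt β ι n'), Squarefree n' →
        (∀ ℓ ∈ n'.primeFactors, Zhang2014.IsKolyvaginPrime N W K p ℓ ∧ M + 1 ≤ Zhang2014.kolyvaginIndex W p ℓ) →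
        PDiv d' p M) →
      ¬ PDiv d p (M + 1) →
      ∃ (n' : ℕ) (d' : KolyvaginHeegnerData Dt β ι n'), Squarefree n' ∧
        (∀ ℓ ∈ n'.primeFactors, Zhang2014.IsKolyvaginPrime N W K p ℓ ∧ e ≤ Zhang2014.kolyvaginIndex W p ℓ) ∧
        ¬ PDiv d' p (M + 1)) :
    ∃ mInf : ℕ,
      (∀ (n : ℕ) (d : KolyvaginHeegnerData Dt β ι n), Squarefree n →
        (∀ ℓ ∈ n.primeFactors, Zhang2014.IsKolyvaginPrime N W K p ℓ) →
        (mInf : ℕ∞) ≤ (if divOrd d p < Zhang2014.levelIndex W p n then divOrd d p else ⊤)) ∧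
      (∀ m' : ℕ, ∃ (n : ℕ) (d : KolyvaginHeegnerData Dt β ι n), Squarefree n ∧
        (∀ ℓ ∈ n.primeFactors, Zhang2014.IsKolyvaginPrime N W K p ℓ) ∧
        (m' : ℕ∞) ≤ Zhang2014.levelIndex W p n ∧
        (if divOrd d p < Zhang2014.levelIndex W p n then divOrd d p else (⊤ : ℕ∞)) = mInf) := by
  -- the set of FINITE values `ord_p(P_n) < M(n)` over admissible `(n, d)`
  let S : Set ℕ := {u | ∃ (n : ℕ) (d : KolyvaginHeegnerData Dt β ι n), Squarefree n ∧
    (∀ ℓ ∈ n.primeFactors, Zhang2014.IsKolyvaginPrime N W K p ℓ) ∧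
    divOrd d p = (u : ℕ∞) ∧ (u : ℕ∞) < Zhang2014.levelIndex W p n}
  -- membership of every finite value
  have hmemS : ∀ (n : ℕ) (d : KolyvaginHeegnerData Dt β ι n), Squarefree n →
      (∀ ℓ ∈ n.primeFactors, Zhang2014.IsKolyvaginPrime N W K p ℓ) →
      divOrd d p < Zhang2014.levelIndex W p n → (divOrd d p).toNat ∈ S ∧ divOrd d p = ((divOrd d p).toNat : ℕ∞) := by
    intro n d hn hadm hlt
    have hne : divOrd d p ≠ ⊤ := ne_top_of_lt hlt
    have heq : divOrd d p = ((divOrd d p).toNat : ℕ∞) := (ENat.coe_toNat hne).symm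
    exact ⟨⟨n, d, hn, hadm, heq, heq ▸ hlt⟩, heq⟩
  obtain ⟨n₀, d₀, hn₀, hadm₀, hlt₀⟩ := hfin
  have hS : S.Nonempty := ⟨_, (hmemS n₀ d₀ hn₀ hadm₀ hlt₀).1⟩
  -- `m_∞ := min S`
  set mInf : ℕ := sInf S with hmInf_def
  have hmem : mInf ∈ S := Nat.sInf_mem hS
  have hle : ∀ u ∈ S, mInf ≤ u := fun u hu => Nat.sInf_le hu
  -- clause 1: `m_∞ ≤ m(n, d)` for every admissible `(n, d)`
  have hclause1 : ∀ (n : ℕ) (d : KolyvaginHeegnerData Dt β ι n), Squarefree n →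
      (∀ ℓ ∈ n.primeFactors, Zhang2014.IsKolyvaginPrime N W K p ℓ) →
      (mInf : ℕ∞) ≤ (if divOrd d p < Zhang2014.levelIndex W p n then divOrd d p else ⊤) := by
    intro n d hn hadm
    by_cases h : divOrd d p < Zhang2014.levelIndex W p n
    · rw [if_pos h]
      obtain ⟨hu, heq⟩ := hmemS n d hn hadm h
      rw [heq]
      exact_mod_cast hle _ hu
    · rw [if_neg h]; exact le_top
  -- consequence of minimality: over index `≥ m_∞ + 1`, every `P_{n'}` is `p^{m_∞}`-divisible
  have hall : ∀ (n' : ℕ) (d' : KolyvaginHeegnerData Dt β ι n'), Squarefree n' →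
      (∀ ℓ ∈ n'.primeFactors, Zhang2014.IsKolyvaginPrime N W K p ℓ ∧ mInf + 1 ≤ Zhang2014.kolyvaginIndex W p ℓ) →
      PDiv d' p mInf := by
    intro n' d' hn' hadm'
    apply pDiv_of_le_divOrd d' p mInf
    by_cases h : divOrd d' p < Zhang2014.levelIndex W p n'
    · obtain ⟨hu, heq⟩ := hmemS n' d' hn' (fun ℓ hℓ => (hadm' ℓ hℓ).1) h
      rw [heq]
      exact_mod_cast hle _ hu
    · have hidx : ((mInf + 1 : ℕ) : ℕ∞) ≤ Zhang2014.levelIndex W p n' :=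
        Zhang2014.natCast_le_levelIndex_iff.mpr fun ℓ hℓ => (hadm' ℓ hℓ).2
      calc (mInf : ℕ∞) ≤ ((mInf + 1 : ℕ) : ℕ∞) := by exact_mod_cast Nat.le_succ mInf
        _ ≤ Zhang2014.levelIndex W p n' := hidx
        _ ≤ divOrd d' p := not_lt.mp h
  refine ⟨mInf, hclause1, fun m' => ?_⟩
  -- clause 2: a conductor attaining `m_∞`, then the swap at depth `max m' (m_∞ + 2)`
  obtain ⟨n₁, d₁, hn₁, hadm₁, hdiv₁, hlt₁⟩ := hmem
  have hidx₁ : ∀ ℓ ∈ n₁.primeFactors,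
      Zhang2014.IsKolyvaginPrime N W K p ℓ ∧ mInf + 1 ≤ Zhang2014.kolyvaginIndex W p ℓ := by
    have h1 : ((mInf + 1 : ℕ) : ℕ∞) ≤ Zhang2014.levelIndex W p n₁ := by
      have := Order.add_one_le_of_lt hlt₁
      exact_mod_cast this
    exact fun ℓ hℓ => ⟨hadm₁ ℓ hℓ, Zhang2014.natCast_le_levelIndex_iff.mp h1 ℓ hℓ⟩
  have hnot₁ : ¬ PDiv d₁ p (mInf + 1) := by
    intro h
    have h1 : ((mInf + 1 : ℕ) : ℕ∞) ≤ divOrd d₁ p := natCast_le_divOrd_of_pDiv d₁ p h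
    rw [hdiv₁] at h1
    have : mInf + 1 ≤ mInf := by exact_mod_cast h1
    omega
  obtain ⟨n', d', hn', hidx', hnot'⟩ := hswap mInf (max m' (mInf + 2)) n₁ d₁ hn₁ hidx₁ hall hnot₁
  have hadm' : ∀ ℓ ∈ n'.primeFactors, Zhang2014.IsKolyvaginPrime N W K p ℓ := fun ℓ hℓ => (hidx' ℓ hℓ).1
  have hM' : ((max m' (mInf + 2) : ℕ) : ℕ∞) ≤ Zhang2014.levelIndex W p n' :=
    Zhang2014.natCast_le_levelIndex_iff.mpr fun ℓ hℓ => (hidx' ℓ hℓ).2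
  -- `ord_p(P_{n'}) = m_∞`
  have hdiv' : divOrd d' p = (mInf : ℕ∞) := by
    apply le_antisymm (divOrd_le_of_not_pDiv d' p hnot')
    exact natCast_le_divOrd_of_pDiv d' p
      (hall n' d' hn' fun ℓ hℓ => ⟨(hidx' ℓ hℓ).1, le_trans (by omega) (le_trans (le_max_right _ _) (hidx' ℓ hℓ).2)⟩)
  have hlt' : divOrd d' p < Zhang2014.levelIndex W p n' := by
    rw [hdiv']
    calc (mInf : ℕ∞) < ((max m' (mInf + 2) : ℕ) : ℕ∞) := by exact_mod_cast (by omega : mInf < max m' (mInf + 2))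
      _ ≤ Zhang2014.levelIndex W p n' := hM'
  refine ⟨n', d', hn', hadm', le_trans (by exact_mod_cast le_max_left m' (mInf + 2)) hM', ?_⟩
  rw [if_pos hlt', hdiv']

end Redefinition

/-! ### §3 The corner max-form displays re-keyed: stub ⟸ {hfin, hswap, hlev} -/

/-- **`stub_kolyJ_max` (19947 v2) ⟸ {hfin, hswap, hlev} at the (T4′) corner frames.** Frame binders VERBATIM those of the
registered stub; `hfin` ∕ `hswap` as in `kolyvaginRedefinition_of_swap` (per frame), `hlev` as in
`nonSurjCornerKolyJ_max_of_perLevel`. CONDITIONAL; nothing booked. [cite: Jetchev2008, Thm. 1.4 (p. 812)]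
[cite: McCallumLMS1991, §5 Prop. 5.2 (p. 304)] [cite: BurungaleEtAl2026, Prop. 2.2.1 (§2.2)] -/
theorem nonSurjCornerKolyJ_max_of_swap_of_perLevel
    (hfin : ∀ (W : WeierstrassCurve ℚ) [W.IsElliptic] [W.IsGloballyMinimal] [NeZero (W.conductorNorm ℤ)]
      (p : ℕ) [Fact p.Prime] (K : Type) [Field K] [NumberField K]
      (Dt : ModularParametrizationData W (W.conductorNorm ℤ)) (β : ℤ) (ι : K →+* ℂ),
      p ∣ W.tamagawaProduct →
      ClassX11b W p → ¬ Surj W p → (p = 5 ∨ p = 7) → p ∣ padicValInt p W.minimalDiscriminantInt →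
      ¬ Ram W p → IsImaginaryQuadratic K → 4 < (NumberField.discr K).natAbs →
      SatisfiesHeegnerHypothesis (W.conductorNorm ℤ) K → SatisfiesHeegnerHypothesis p K →
      (4 * (W.conductorNorm ℤ : ℤ)) ∣ β ^ 2 - NumberField.discr K → ¬ (p : ℤ) ∣ Dt.c →
      ∃ (n : ℕ) (d : KolyvaginHeegnerData Dt β ι n), Squarefree n ∧
        (∀ ℓ ∈ n.primeFactors, Zhang2014.IsKolyvaginPrime (W.conductorNorm ℤ) W K p ℓ) ∧
        divOrd d p < Zhang2014.levelIndex W p n)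
    (hswap : ∀ (W : WeierstrassCurve ℚ) [W.IsElliptic] [W.IsGloballyMinimal] [NeZero (W.conductorNorm ℤ)]
      (p : ℕ) [Fact p.Prime] (K : Type) [Field K] [NumberField K]
      (Dt : ModularParametrizationData W (W.conductorNorm ℤ)) (β : ℤ) (ι : K →+* ℂ),
      p ∣ W.tamagawaProduct →
      ClassX11b W p → ¬ Surj W p → (p = 5 ∨ p = 7) → p ∣ padicValInt p W.minimalDiscriminantInt →
      ¬ Ram W p → IsImaginaryQuadratic K → 4 < (NumberField.discr K).natAbs →
      SatisfiesHeegnerHypothesis (W.conductorNorm ℤ) K → SatisfiesHeegnerHypothesis p K →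
      (4 * (W.conductorNorm ℤ : ℤ)) ∣ β ^ 2 - NumberField.discr K → ¬ (p : ℤ) ∣ Dt.c →
      ∀ (M e : ℕ) (n : ℕ) (d : KolyvaginHeegnerData Dt β ι n), Squarefree n →
        (∀ ℓ ∈ n.primeFactors, Zhang2014.IsKolyvaginPrime (W.conductorNorm ℤ) W K p ℓ ∧
          M + 1 ≤ Zhang2014.kolyvaginIndex W p ℓ) →
        (∀ (n' : ℕ) (d' : KolyvaginHeegnerData Dt β ι n'), Squarefree n' →
          (∀ ℓ ∈ n'.primeFactors, Zhang2014.IsKolyvaginPrime (W.conductorNorm ℤ) W K p ℓ ∧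
            M + 1 ≤ Zhang2014.kolyvaginIndex W p ℓ) → PDiv d' p M) →
        ¬ PDiv d p (M + 1) →
        ∃ (n' : ℕ) (d' : KolyvaginHeegnerData Dt β ι n'), Squarefree n' ∧
          (∀ ℓ ∈ n'.primeFactors, Zhang2014.IsKolyvaginPrime (W.conductorNorm ℤ) W K p ℓ ∧
            e ≤ Zhang2014.kolyvaginIndex W p ℓ) ∧ ¬ PDiv d' p (M + 1))
    (hlev : ∀ (W : WeierstrassCurve ℚ) [W.IsElliptic] [W.IsGloballyMinimal] [NeZero (W.conductorNorm ℤ)]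
      (p : ℕ) [Fact p.Prime] (K : Type) [Field K] [NumberField K]
      (Dt : ModularParametrizationData W (W.conductorNorm ℤ)) (β : ℤ) (ι : K →+* ℂ),
      p ∣ W.tamagawaProduct →
      ClassX11b W p → ¬ Surj W p → (p = 5 ∨ p = 7) → p ∣ padicValInt p W.minimalDiscriminantInt →
      ¬ Ram W p → IsImaginaryQuadratic K → 4 < (NumberField.discr K).natAbs →
      SatisfiesHeegnerHypothesis (W.conductorNorm ℤ) K → SatisfiesHeegnerHypothesis p K →
      (4 * (W.conductorNorm ℤ : ℤ)) ∣ β ^ 2 - NumberField.discr K → ¬ (p : ℤ) ∣ Dt.c →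
      ∀ (v : HeightOneSpectrum (𝓞 ℚ)) (k n : ℕ) (d : KolyvaginHeegnerData Dt β ι n), Squarefree n →
        (∀ ℓ ∈ n.primeFactors, Zhang2014.IsKolyvaginPrime (W.conductorNorm ℤ) W K p ℓ) →
        (if divOrd d p < Zhang2014.levelIndex W p n then divOrd d p else (⊤ : ℕ∞)) < (k : ℕ∞) →
        padicValNat p (W.tamagawaNumberAt v) ≤ k →
        (k : ℕ∞) + (if divOrd d p < Zhang2014.levelIndex W p n then divOrd d p else ⊤) ≤
          Zhang2014.levelIndex W p n →
        (padicValNat p (W.tamagawaNumberAt v) : ℕ∞) ≤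
          (if divOrd d p < Zhang2014.levelIndex W p n then divOrd d p else ⊤)) :
    ∀ (W : WeierstrassCurve ℚ) [W.IsElliptic] [W.IsGloballyMinimal] [NeZero (W.conductorNorm ℤ)]
      (p : ℕ) [Fact p.Prime] (K : Type) [Field K] [NumberField K]
      (Dt : ModularParametrizationData W (W.conductorNorm ℤ)) (β : ℤ) (ι : K →+* ℂ),
      p ∣ W.tamagawaProduct →
      ClassX11b W p → ¬ Surj W p → (p = 5 ∨ p = 7) → p ∣ padicValInt p W.minimalDiscriminantInt →
      ¬ Ram W p → IsImaginaryQuadratic K → 4 < (NumberField.discr K).natAbs →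
      SatisfiesHeegnerHypothesis (W.conductorNorm ℤ) K → SatisfiesHeegnerHypothesis p K →
      (4 * (W.conductorNorm ℤ : ℤ)) ∣ β ^ 2 - NumberField.discr K → ¬ (p : ℤ) ∣ Dt.c →
      ∀ (v : HeightOneSpectrum (𝓞 ℚ)) (s : ℕ), s ≤ padicValNat p (W.tamagawaNumberAt v) →
        ∀ (n : ℕ) (d : KolyvaginHeegnerData Dt β ι n), Squarefree n →
          (∀ ℓ ∈ n.primeFactors, Zhang2014.IsKolyvaginPrime (W.conductorNorm ℤ) W K p ℓ ∧
            s ≤ Zhang2014.kolyvaginIndex W p ℓ) → PDiv d p s :=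
  nonSurjCornerKolyJ_max_of_perLevel
    (fun W _ _ _ p _ K _ _ Dt β ι htam hX hns h57 hv hnr hK' hd hHN hHp hβ hc =>
      kolyvaginRedefinition_of_swap p
        (hfin W p K Dt β ι htam hX hns h57 hv hnr hK' hd hHN hHp hβ hc)
        (hswap W p K Dt β ι htam hX hns h57 hv hnr hK' hd hHN hHp hβ hc))
    hlev

/-- **`stub_upper3_jetchevMax` (19111 Upper kit) ⟸ {hfin, hswap, hlev} at the (T4″)@3 corner frames.** Same proof at
`p = 3`. CONDITIONAL; nothing booked. [cite: Jetchev2008, Thm. 1.4 (p. 812)] [cite: McCallumLMS1991, §5 Prop. 5.2 (p. 304)]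
[cite: BurungaleEtAl2026, Prop. 2.2.1 (§2.2)] -/
theorem cornerUpper3_jetchevMax_of_swap_of_perLevel
    (hfin : ∀ (W : WeierstrassCurve ℚ) [W.IsElliptic] [W.IsGloballyMinimal] [NeZero (W.conductorNorm ℤ)]
      (K : Type) [Field K] [NumberField K]
      (Dt : ModularParametrizationData W (W.conductorNorm ℤ)) (β : ℤ) (ι : K →+* ℂ),
      ClassX11b W 3 → ¬ Surj W 3 →
      IsImaginaryQuadratic K → SatisfiesHeegnerHypothesis (W.conductorNorm ℤ) K →
      Odd (NumberField.discr K) →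
      (4 * (W.conductorNorm ℤ : ℤ)) ∣ β ^ 2 - NumberField.discr K → ¬ (3 : ℤ) ∣ Dt.c →
      ∃ (n : ℕ) (d : KolyvaginHeegnerData Dt β ι n), Squarefree n ∧
        (∀ ℓ ∈ n.primeFactors, Zhang2014.IsKolyvaginPrime (W.conductorNorm ℤ) W K 3 ℓ) ∧
        divOrd d 3 < Zhang2014.levelIndex W 3 n)
    (hswap : ∀ (W : WeierstrassCurve ℚ) [W.IsElliptic] [W.IsGloballyMinimal] [NeZero (W.conductorNorm ℤ)]
      (K : Type) [Field K] [NumberField K]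
      (Dt : ModularParametrizationData W (W.conductorNorm ℤ)) (β : ℤ) (ι : K →+* ℂ),
      ClassX11b W 3 → ¬ Surj W 3 →
      IsImaginaryQuadratic K → SatisfiesHeegnerHypothesis (W.conductorNorm ℤ) K →
      Odd (NumberField.discr K) →
      (4 * (W.conductorNorm ℤ : ℤ)) ∣ β ^ 2 - NumberField.discr K → ¬ (3 : ℤ) ∣ Dt.c →
      ∀ (M e : ℕ) (n : ℕ) (d : KolyvaginHeegnerData Dt β ι n), Squarefree n →
        (∀ ℓ ∈ n.primeFactors, Zhang2014.IsKolyvaginPrime (W.conductorNorm ℤ) W K 3 ℓ ∧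
          M + 1 ≤ Zhang2014.kolyvaginIndex W 3 ℓ) →
        (∀ (n' : ℕ) (d' : KolyvaginHeegnerData Dt β ι n'), Squarefree n' →
          (∀ ℓ ∈ n'.primeFactors, Zhang2014.IsKolyvaginPrime (W.conductorNorm ℤ) W K 3 ℓ ∧
            M + 1 ≤ Zhang2014.kolyvaginIndex W 3 ℓ) → PDiv d' 3 M) →
        ¬ PDiv d 3 (M + 1) →
        ∃ (n' : ℕ) (d' : KolyvaginHeegnerData Dt β ι n'), Squarefree n' ∧
          (∀ ℓ ∈ n'.primeFactors, Zhang2014.IsKolyvaginPrime (W.conductorNorm ℤ) W K 3 ℓ ∧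
            e ≤ Zhang2014.kolyvaginIndex W 3 ℓ) ∧ ¬ PDiv d' 3 (M + 1))
    (hlev : ∀ (W : WeierstrassCurve ℚ) [W.IsElliptic] [W.IsGloballyMinimal] [NeZero (W.conductorNorm ℤ)]
      (K : Type) [Field K] [NumberField K]
      (Dt : ModularParametrizationData W (W.conductorNorm ℤ)) (β : ℤ) (ι : K →+* ℂ),
      ClassX11b W 3 → ¬ Surj W 3 →
      IsImaginaryQuadratic K → SatisfiesHeegnerHypothesis (W.conductorNorm ℤ) K →
      Odd (NumberField.discr K) →
      (4 * (W.conductorNorm ℤ : ℤ)) ∣ β ^ 2 - NumberField.discr K → ¬ (3 : ℤ) ∣ Dt.c →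
      ∀ (v : HeightOneSpectrum (𝓞 ℚ)) (k n : ℕ) (d : KolyvaginHeegnerData Dt β ι n), Squarefree n →
        (∀ ℓ ∈ n.primeFactors, Zhang2014.IsKolyvaginPrime (W.conductorNorm ℤ) W K 3 ℓ) →
        (if divOrd d 3 < Zhang2014.levelIndex W 3 n then divOrd d 3 else (⊤ : ℕ∞)) < (k : ℕ∞) →
        padicValNat 3 (W.tamagawaNumberAt v) ≤ k →
        (k : ℕ∞) + (if divOrd d 3 < Zhang2014.levelIndex W 3 n then divOrd d 3 else ⊤) ≤
          Zhang2014.levelIndex W 3 n →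
        (padicValNat 3 (W.tamagawaNumberAt v) : ℕ∞) ≤
          (if divOrd d 3 < Zhang2014.levelIndex W 3 n then divOrd d 3 else ⊤)) :
    ∀ (W : WeierstrassCurve ℚ) [W.IsElliptic] [W.IsGloballyMinimal] [NeZero (W.conductorNorm ℤ)]
      (K : Type) [Field K] [NumberField K]
      (Dt : ModularParametrizationData W (W.conductorNorm ℤ)) (β : ℤ) (ι : K →+* ℂ),
      ClassX11b W 3 → ¬ Surj W 3 →
      IsImaginaryQuadratic K → SatisfiesHeegnerHypothesis (W.conductorNorm ℤ) K →
      Odd (NumberField.discr K) →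
      (4 * (W.conductorNorm ℤ : ℤ)) ∣ β ^ 2 - NumberField.discr K → ¬ (3 : ℤ) ∣ Dt.c →
      ∀ (v : HeightOneSpectrum (𝓞 ℚ)) (s : ℕ), s ≤ padicValNat 3 (W.tamagawaNumberAt v) →
        ∀ (n : ℕ) (d : KolyvaginHeegnerData Dt β ι n), Squarefree n →
          (∀ ℓ ∈ n.primeFactors, Zhang2014.IsKolyvaginPrime (W.conductorNorm ℤ) W K 3 ℓ ∧
            s ≤ Zhang2014.kolyvaginIndex W 3 ℓ) → PDiv d 3 s :=
  cornerUpper3_jetchevMax_of_perLevel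
    (fun W _ _ _ K _ _ Dt β ι hX hns hK' hHN hodd hβ hc =>
      kolyvaginRedefinition_of_swap 3
        (hfin W K Dt β ι hX hns hK' hHN hodd hβ hc) (hswap W K Dt β ι hX hns hK' hHN hodd hβ hc))
    hlev

end Summit.BirchSwinnertonDyer.Rank1Residual.X11b.Three.Koly

end
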